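import Literature.NumberTheory.EllipticCurves.LocalTateSelfDualityTorsion
import Literature.NumberTheory.EllipticCurves.SelmerTorsionInclusion
import Literature.NumberTheory.GaloisRepresentations.ContinuousShapiroOpenCoinducedDescent
import Literature.AnabelianGeometry.AbsoluteAnabelian.GaloisCyclotomeH2Levels
import HarnessLib

/-!
# Level change for the local Tate self-pairings of `E[N]` and `E[n]`, `n d = N`: `⟨d x, d y⟩_n = ⟨x, y⟩_N mod n`

Topic `NumberTheory/EllipticCurves`; namespace `Literature.NumberTheory.EllipticCurves`. Sequel of
`LocalTateSelfDualityTorsion.lean` (brick K2 floor (a) of the hT₂ programme of crux K★ stmt-BirchSwinnertonDyer-22226,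
memo `Summits/BirchSwinnertonDyer/BirchSwinnertonDyer/Cruxes/StarredOptimalManinUnitFiveSeven/Lines/kato-lever-hT2-programme.md`
§4): floor (b), second half — the COMPATIBILITY IN THE LEVEL that makes the self-pairings `⟨·,·⟩_{p^k}` on
`H¹(F, E[p^k]|_{Γ_F})` a coherent `ℤ_p = lim ℤ/p^k`-valued pairing on `H¹(F, T_pW) = lim_k H¹(F, E[p^k])` (floor (c)).
Definitions with bodies and theorems; no named fact, no instance, no `sorry`.

For levels `n d = N`, Weil pairings `e_N` on `E[N]` and `e_n` on `E[n]` COMPATIBLE in Silverman's sense III.8.1 (e)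
(`e_n(dS, dT) = e_N(S, T)^d`, which the tree PROVES for its constructed Weil pairing:
`WeierstrassCurve.weilPairingFun_zsmul_zsmul` / `weilPairingFun_pow_succ` / `exists_weilPairing_tower`), and THE
invariant maps `inv_n = Prop121vii.invLevel F n` of the tree (compatible along the power maps: `invLevel_muPowHom`,
`inv_n((ζ ↦ ζ^d)_* c) = inv_N(c) mod n`):

* `torsionMulHom` / `torsionMulMor` — multiplication by `d`, `E[N]|_{Γ_F} → E[n]|_{Γ_F}` (`Γ_F`-equivariant): the
  `ℕ`-level form (levels `n d = N` as in `invLevel_muPowHom`) of the tree's `geomTorsionZSMul W (d : ℤ) _`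
  (`SelmerTorsionInclusion.lean`, the map under the Selmer-side `H¹` transition maps `torsionH1OfDvd` / `resH1Hom`),
  DEFINED as that map (`torsionMulHom_eq_geomTorsionZSMul : … = … := rfl`) so that the `ℤ_p`-limit consumers meet one object;
* `muPowRes` — the power map `ζ ↦ ζ^d` on the RESTRICTED modules `μ_N(K̄₀)|_{Γ_F} → μₙ(K̄₀)|_{Γ_F}` (the value groups of
  the restricted Weil cup products of `LocalWeilPairingDuality.lean`; DEFINED as `(TopRep.resFunctor _).map (muPowHom K₀ N n d h)`), `muTransfer_muPow` (it commutes with the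
  transfers `muRestrictIso` to `μ(F̄)` and the tree's `muPowHom F`), `cohomologyMap_muRestrictIso_muPowRes` (the same on `H²`);
* `cohomologyMap_muPowRes_weilCupProduct` — **`(ζ ↦ ζ^d)_* (x ∪_{e_N} y) = (d_* x) ∪_{e_n} (d_* y)`** (covariant
  naturality of the cup product, `ContPairing.cupProduct_map`);
* ★ `levelTatePairing_invLevel_levelChange` — **`⟨d_* x, d_* y⟩_{n, inv_n} = ⟨x, y⟩_{N, inv_N} mod n`**
  (`ZMod.castHom`), over a non-archimedean local field `F ⊇ K₀` of characteristic `0`.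

BSD is not proved by any of this.

## References
* J. H. Silverman, *The Arithmetic of Elliptic Curves*, 2nd ed. 2009, Prop. III.8.1 (e). [SilvermanAEC2009]
* J. Neukirch, A. Schmidt, K. Wingberg, *Cohomology of Number Fields*, 2008, I §4 (1.4.2), (7.2.6);
  B. Perrin-Riou, Invent. Math. 115 (1994) §3.6.1 (the `Λ`-adic pairing as a limit of finite-level pairings).
  [NeukirchSchmidtWingberg2008]
* J.-P. Serre, *Local Fields*, 1979, XIII §3 (invariant maps and change of level). [SerreLocalFields1979]
-/

noncomputable section

open CategoryTheory Function Field
open Literature.NumberTheory.GaloisRepresentations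
open Literature.NumberTheory.GaloisRepresentations.DiscreteGaloisModule (mu MuCarrier)
open Literature.AnabelianGeometry.AbsoluteAnabelian (muPow muPowHom muVal_muPow)

universe u

namespace Literature.NumberTheory.EllipticCurves

open _root_.WeierstrassCurve

attribute [local instance] absoluteGaloisGroup_compactSpace
attribute [local instance] finite_geomTorsion_of_neZero

variable {K₀ : Type u} [Field K₀] (W : WeierstrassCurve K₀) [W.IsElliptic] (F : Type u) [Field F] [Algebra K₀ F]
  (N n d : ℕ) [NeZero N] [NeZero n] (h : n * d = N)

/-! ### Multiplication by `d`: `E[N] → E[n]` -/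

omit [W.IsElliptic] [NeZero N] [NeZero n] in
include h in
/-- Level bookkeeping: `N ∣ n · d` in `ℤ` for `n d = N`. [folklore] -/
private theorem natCast_dvd_mul_of_eq : (N : ℤ) ∣ (n : ℤ) * (d : ℤ) :=
  dvd_of_eq (by exact_mod_cast h.symm)

/-- **Multiplication by `d`, `E[N] → E[n]`** (`n d = N`), on the geometric torsion of `W/K₀`: the tree's
`geomTorsionZSMul W (d : ℤ) _` (`SelmerTorsionInclusion.lean`) at the `ℕ`-levels `n d = N` of `invLevel_muPowHom`
(DEFINITIONALLY that map: `torsionMulHom_eq_geomTorsionZSMul`). [cite: SilvermanAEC2009, Prop. III.8.1 (e)] -/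
def torsionMulHom : geomTorsion W N →+ geomTorsion W n :=
  geomTorsionZSMul W (d : ℤ) (natCast_dvd_mul_of_eq N n d h)

omit [W.IsElliptic] [NeZero N] [NeZero n] in
/-- `torsionMulHom` IS the tree's `geomTorsionZSMul` (by `rfl`): one object for the Selmer-side transition maps
(`torsionH1OfDvd`, `resH1Hom` over `geomTorsionZSMul`) and for the `ℤ_p`-limit of the local Tate pairings.
[cite: SilvermanAEC2009, Prop. III.8.1 (e)] -/
theorem torsionMulHom_eq_geomTorsionZSMul :
    torsionMulHom W N n d h = geomTorsionZSMul W (d : ℤ) (natCast_dvd_mul_of_eq N n d h) := rfl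

omit [W.IsElliptic] [NeZero N] [NeZero n] in
/-- Unfolding `torsionMulHom` on underlying points: `d • T` (= `coe_geomTorsionZSMul`). [cite: SilvermanAEC2009, Prop. III.8.1 (e)] -/
@[simp] theorem coe_torsionMulHom (T : geomTorsion W N) :
    ((torsionMulHom W N n d h T : geomTorsion W n) : geomPoints W) = (d : ℤ) • (T : geomPoints W) := rfl

omit [W.IsElliptic] [NeZero N] [NeZero n] in
/-- Multiplication by `d` commutes with the Galois action (`Γ_F` through `Γ_{K₀}`; `geomTorsionZSMul_smul`).
[cite: SilvermanAEC2009, Prop. III.8.1 (e)] -/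
theorem torsionMulHom_smul (σ : absoluteGaloisGroup F) (T : geomTorsion W N) :
    torsionMulHom W N n d h (torsionRestricted W F N σ T) = torsionRestricted W F n σ (torsionMulHom W N n d h T) := by
  rw [torsionRestricted_apply_apply, torsionRestricted_apply_apply]
  exact geomTorsionZSMul_smul W (d : ℤ) (natCast_dvd_mul_of_eq N n d h) (absGaloisRestrict K₀ F σ) T

/-- Multiplication by `d` as a morphism of topological `Γ_F`-representations `E[N]|_{Γ_F} ⟶ E[n]|_{Γ_F}`.
[cite: SilvermanAEC2009, Prop. III.8.1 (e)] -/
def torsionMulMor : (torsionRestricted W F N).toTopRep ⟶ (torsionRestricted W F n).toTopRep :=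
  TopRep.ofHom
    { toFun := torsionMulHom W N n d h
      map_add' := map_add _
      map_smul' := fun c T => map_zsmul _ c T
      cont := continuous_of_discreteTopology
      isIntertwining' := fun σ => ContinuousLinearMap.ext fun T => torsionMulHom_smul W F N n d h σ T }

omit [W.IsElliptic] [NeZero N] [NeZero n] in
/-- Unfolding `torsionMulMor`. [cite: SilvermanAEC2009, Prop. III.8.1 (e)] -/
@[simp] theorem torsionMulMor_hom_apply (T : geomTorsion W N) :
    (torsionMulMor W F N n d h).hom T = torsionMulHom W N n d h T := rfl

/-! ### The power map on the restricted roots of unity and its comparison with the transfers -/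

omit [W.IsElliptic] [NeZero N] [NeZero n] in
/-- **The power map `ζ ↦ ζ^d` on the RESTRICTED modules `μ_N(K̄₀)|_{Γ_F} ⟶ μₙ(K̄₀)|_{Γ_F}`** (the value groups of the
restricted Weil cup products of `LocalWeilPairingDuality.lean`): the functorial image `(TopRep.resFunctor _).map` of the
tree's `muPowHom K₀ N n d h` (so consumers holding `resFunctor.map muPowHom` meet one object; `muPowRes_hom_apply`).
[cite: SerreLocalFields1979, XIII §3] -/
def muPowRes :
    TopRep.res (absGaloisRestrict K₀ F : absoluteGaloisGroup F →* absoluteGaloisGroup K₀) (mu K₀ N).toTopRep ⟶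
      TopRep.res (absGaloisRestrict K₀ F : absoluteGaloisGroup F →* absoluteGaloisGroup K₀) (mu K₀ n).toTopRep :=
  (TopRep.resFunctor (absGaloisRestrict K₀ F : absoluteGaloisGroup F →* absoluteGaloisGroup K₀)).map (muPowHom K₀ N n d h)

omit [W.IsElliptic] [NeZero N] [NeZero n] in
/-- Unfolding `muPowRes`. [cite: SerreLocalFields1979, XIII §3] -/
@[simp] theorem muPowRes_hom_apply (v : MuCarrier K₀ N) :
    (muPowRes F N n d h).hom v = muPow K₀ N n d h v := rfl

omit [NeZero N] [NeZero n] in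
/-- `ι(ζ^d) = ι(ζ)^d` for the transfer `ι : μ(K̄₀) → μ(F̄)` along the chosen embedding `K̄₀ → F̄`.
[cite: SerreLocalFields1979, XIII §3] -/
theorem muTransfer_muPow (v : MuCarrier K₀ N) :
    muTransfer K₀ F n (muPow K₀ N n d h v) = muPow F N n d h (muTransfer K₀ F N v) := by
  apply muVal_injective F n
  rw [muVal_muTransfer, muVal_muPow, muVal_muPow, muVal_muTransfer, map_pow]

omit [W.IsElliptic] in
/-- **The transfers `μ(K̄₀)|_{Γ_F} ≅ μ(F̄)` commute with the power maps on `H²`**: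
`H²(ι_n)(H²(d-th power|res) c) = H²(d-th power on μ(F̄))(H²(ι_N) c)` (both are `H²` of the same composite morphism,
`muTransfer_muPow`). [cite: SerreLocalFields1979, XIII §3] -/
theorem cohomologyMap_muRestrictIso_muPowRes [CharZero K₀] [CharZero F]
    (c : continuousCohomology 2
      (TopRep.res (absGaloisRestrict K₀ F : absoluteGaloisGroup F →* absoluteGaloisGroup K₀) (mu K₀ N).toTopRep)) :
    cohomologyMap (muRestrictIso K₀ n F).hom 2 (cohomologyMap (muPowRes F N n d h) 2 c) =
      cohomologyMap (muPowHom F N n d h) 2 (cohomologyMap (muRestrictIso K₀ N F).hom 2 c) := by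
  rw [cohomologyMap_comp_apply_of_eq (muPowRes F N n d h) (muRestrictIso K₀ n F).hom
      (muPowRes F N n d h ≫ (muRestrictIso K₀ n F).hom) (fun _ => rfl) 2 c,
    cohomologyMap_comp_apply_of_eq (muRestrictIso K₀ N F).hom (muPowHom F N n d h)
      (muPowRes F N n d h ≫ (muRestrictIso K₀ n F).hom) (fun v => ?_) 2 c]
  change muPow F N n d h (muTransfer K₀ F N v) = muTransfer K₀ F n (muPow K₀ N n d h v)
  rw [muTransfer_muPow]

/-! ### Compatible Weil pairings and the cup product -/

variable (eN : geomTorsion W N → geomTorsion W N → AlgebraicClosure K₀)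
  (hμN : ∀ S T, eN S T ^ N = 1)
  (haddN₁ : ∀ S₁ S₂ T, eN (S₁ + S₂) T = eN S₁ T * eN S₂ T)
  (haddN₂ : ∀ S T₁ T₂, eN S (T₁ + T₂) = eN S T₁ * eN S T₂)
  (hgalN : ∀ (σ : absoluteGaloisGroup K₀) (S T : geomTorsion W N), σ • eN S T = eN (σ • S) (σ • T))
  (en : geomTorsion W n → geomTorsion W n → AlgebraicClosure K₀)
  (hμn : ∀ S T, en S T ^ n = 1)
  (haddn₁ : ∀ S₁ S₂ T, en (S₁ + S₂) T = en S₁ T * en S₂ T)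
  (haddn₂ : ∀ S T₁ T₂, en S (T₁ + T₂) = en S T₁ * en S T₂)
  (hgaln : ∀ (σ : absoluteGaloisGroup K₀) (S T : geomTorsion W n), σ • en S T = en (σ • S) (σ • T))
  (hcompat : ∀ S T : geomTorsion W N, en (torsionMulHom W N n d h S) (torsionMulHom W N n d h T) = eN S T ^ d)

omit [W.IsElliptic] in
include hcompat in
/-- The compatibility `e_n(dS, dT) = e_N(S, T)^d` in the additive currency: `(e_N(S, T))^d = e_n(dS, dT)` in `μₙ(K̄₀)`.
[cite: SilvermanAEC2009, Prop. III.8.1 (e)] -/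
theorem muPow_weilPairingHom (S T : geomTorsion W N) :
    muPow K₀ N n d h (weilPairingHom W N eN hμN haddN₁ haddN₂ S T) =
      weilPairingHom W n en hμn haddn₁ haddn₂ (torsionMulHom W N n d h S) (torsionMulHom W N n d h T) := by
  apply muVal_injective K₀ n
  apply Units.ext
  rw [muVal_muPow, Units.val_pow_eq_pow_val]
  change (((MuCarrier.toAdditive (weilPairingHom W N eN hμN haddN₁ haddN₂ S T)).toMul :
      (AlgebraicClosure K₀)ˣ) : AlgebraicClosure K₀) ^ d =
    (((MuCarrier.toAdditive (weilPairingHom W n en hμn haddn₁ haddn₂ (torsionMulHom W N n d h S)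
      (torsionMulHom W N n d h T))).toMul : (AlgebraicClosure K₀)ˣ) : AlgebraicClosure K₀)
  rw [coe_weilPairingHom, coe_weilPairingHom, hcompat]

omit [W.IsElliptic] in
include hcompat in
/-- **Covariant naturality of the restricted Weil cup product along the level**:
`(ζ ↦ ζ^d)_* (x ∪_{e_N} y) = (d_* x) ∪_{e_n} (d_* y)` in `H²(Γ_F, μₙ(K̄₀)|_{Γ_F})`. [cite: NeukirchSchmidtWingberg2008, I §4 (1.4.2)]
[cite: SilvermanAEC2009, Prop. III.8.1 (e)] -/
theorem cohomologyMap_muPowRes_weilCupProduct (x y : continuousCohomology 1 (torsionRestricted W F N).toTopRep) :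
    cohomologyMap (muPowRes F N n d h) 2
        (((weilContPairing W N eN hμN haddN₁ haddN₂ hgalN).restrict (absGaloisRestrict K₀ F)).cupProduct x y) =
      ((weilContPairing W n en hμn haddn₁ haddn₂ hgaln).restrict (absGaloisRestrict K₀ F)).cupProduct
        (cohomologyMap (torsionMulMor W F N n d h) 1 x) (cohomologyMap (torsionMulMor W F N n d h) 1 y) :=
  ContPairing.cupProduct_map
    ((weilContPairing W N eN hμN haddN₁ haddN₂ hgalN).restrict (absGaloisRestrict K₀ F))
    ((weilContPairing W n en hμn haddn₁ haddn₂ hgaln).restrict (absGaloisRestrict K₀ F))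
    (torsionMulMor W F N n d h) (torsionMulMor W F N n d h) (muPowRes F N n d h)
    (fun S T => by
      rw [muPowRes_hom_apply, ContPairing.restrict_toLin, ContPairing.restrict_toLin, weilContPairing_toLin_apply,
        weilContPairing_toLin_apply]
      exact muPow_weilPairingHom W N n d h eN hμN haddN₁ haddN₂ en hμn haddn₁ haddn₂ hcompat S T)
    x y

include hcompat in
/-- ★ **Level change for the local Tate self-pairings with THE invariant maps**: for `n d = N`,
`⟨d_* x, d_* y⟩_{n, inv_n} = ⟨x, y⟩_{N, inv_N} mod n`, `inv = Prop121vii.invLevel F` (compatible along the power maps,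
`invLevel_muPowHom`). This is the coherence of the family `(⟨·,·⟩_{p^k})_k` defining the `ℤ_p`-valued local Tate
pairing on `H¹(F, T_pW) = lim_k H¹(F, E[p^k])`. [cite: NeukirchSchmidtWingberg2008, (7.2.6)] [cite: SilvermanAEC2009, Prop. III.8.1 (e)] -/
theorem levelTatePairing_invLevel_levelChange [CharZero K₀] [CharZero F] [ValuativeRel F] [TopologicalSpace F]
    [IsNonarchimedeanLocalField F] (x y : continuousCohomology 1 (torsionRestricted W F N).toTopRep) :
    levelTatePairing W F n en hμn haddn₁ haddn₂ hgaln
        (Literature.AnabelianGeometry.AbsoluteAnabelian.Prop121vii.invLevel F n)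
        (cohomologyMap (torsionMulMor W F N n d h) 1 x) (cohomologyMap (torsionMulMor W F N n d h) 1 y) =
      ZMod.castHom (Dvd.intro d h) (ZMod n)
        (levelTatePairing W F N eN hμN haddN₁ haddN₂ hgalN
          (Literature.AnabelianGeometry.AbsoluteAnabelian.Prop121vii.invLevel F N) x y) := by
  rw [levelTatePairing_eq_iota_weilCupProduct, levelTatePairing_eq_iota_weilCupProduct,
    ← cohomologyMap_muPowRes_weilCupProduct W F N n d h eN hμN haddN₁ haddN₂ hgalN en hμn haddn₁ haddn₂ hgaln hcompat,
    cohomologyMap_muRestrictIso_muPowRes]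
  exact Literature.AnabelianGeometry.AbsoluteAnabelian.invLevel_muPowHom F h _

end Literature.NumberTheory.EllipticCurves

end
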